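import Summits.AnomalousDissipation.AnomalousDissipation.Theorems.SolenoidalFractalHomogenisationLagrangianStepFrameSecondGradient
import Summits.AnomalousDissipation.AnomalousDissipation.Theorems.SolenoidalFractalHomogenisationLagrangianStepFrameCurvature
import HarnessLib

/-!
# K1L_D (stmt-AnomalousDissipation-27980), `stub_Z7_alphaBetaR` α-part: the modulation datum (hmod) of the exact-flow frame FROM THE K8-5
# TEXT OF RECORD `HCURV` — `isModulation_frameG_closed_of_hcurv{,_nat}` (helper, `--supports 27980 --as helper`)

prover ad-k3l-bookkeeping-p1 g9 (tenure D27-8″ (a)).  `FrameForm.isModulation_frameG_closed` (p704979, prover ad-k1loc-p3 g9) gives the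
`CellClauseMod.IsModulation` datum of `frameG` on a closed refresh piece from the sharp curvature hypothesis `hcurv` with a free wavenumber `nC`;
`FrameConj.frameConjugacyAt_of_modulation` (p706082, lead-k1l-onelevel-p1 g5) consumes `hmod : IsModulation θ (a(t − jR)) (ϱ·N m) (frameG …)`
with `0 ≤ θ ≤ Cα·θ (m+1)`.  This file closes the gap between the two modulo the K8-5 text of record **HCURV** (tenure D27-8, author prover
ad-k1loc-p3 g9 07:40:56Z; prover of record lead-k1l-onelevel-p1 g6, closing name `FrameForm.abs_partialDeriv_frameG_le`):
* `isModulation_frameG_closed_of_hcurv (hK85 : HCURV) (k W) : ∃ θs Cα ϱ > 0, ∀ E θ₀, design = W → θ₀ ≤ θs → LPermissible → Regular → (N²) → (T4) →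
  ∀ m (j : ℤ) t, jR < t → t ≤ (j+1)R → IsModulation (Cα·strain m) (a (m+1)·(t − jR)) (ϱ·N m) (fun τ y => frameG E m (jR + τ/a (m+1)) (jR) y)`
  — constants `Cα = 5C + 6C' + C♯ + 1` (`abs_frameG_sub_one_le_strain_closed`, `abs_partialDeriv_partialSum_le`, HCURV), `ϱ = 1`; the five
  window inputs of `isModulation_frameG_of_closed` discharged exactly as in `isModulation_frameG_closed`, plus `hcurv` from HCURV;
* `isModulation_frameG_closed_of_hcurv_nat` — the same with `j : ℕ` and `t ≤ jR + R`, literally the binders of `frameConjugacyAt_of_modulation`.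
When `FrameForm.abs_partialDeriv_frameG_le : HCURV` lands, `isModulation_frameG_closed_of_hcurv abs_partialDeriv_frameG_le` is hypothesis-free.
No sorry, no definition, no named fact.  NOT a proof of `stub_Z7_alphaBetaR`, of K1L_D or of AD; rung F-D1.A0 (a FRONTIER formal rung).
-/

set_option linter.dupNamespace false

noncomputable section

namespace Summit.AnomalousDissipation.AnomalousDissipation.Theorems.SolenoidalFractalHomogenisation.LagrangianStep.FrameForm

open Set Function Filter MeasureTheory Topology
open scoped NNReal
open Literature.Analysis Literature.Analysis.ODE Literature.Analysis.FunctionSpaces Literature.Analysis.FunctionSpaces.Torus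
open Literature.Analysis.FluidPDE Literature.Analysis.FluidPDE.LatticeShear
open Summit.AnomalousDissipation.AnomalousDissipation.Theorems.SolenoidalFractalHomogenisation.LagrangianCarrierConstruction
open Summit.AnomalousDissipation.AnomalousDissipation.Theorems.SolenoidalFractalHomogenisation.LagrangianCarrier

variable {k : ℕ}

/-- **HCURV ⇒ (hmod): THE EXACT-FLOW FRAME IS A MODULATION**, conditional only on the K8-5 text of record `HCURV` (tenure D27-8; to be
discharged BY NAME by lead-k1l-onelevel-p1 g6's `FrameForm.abs_partialDeriv_frameG_le`).  For every design `W` there are `θs, Cα, ϱ > 0` such that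
every `LPermissible`, `Regular` carrier of design `W` with `N_m² ≤ N_{m+1}` and the template (T4) at `θ₀ ≤ θs` has, for every level `m`, window
index `j : ℤ` and piece end `jR < t ≤ (j+1)R`,
`CellClauseMod.IsModulation (Cα·strain m) (a (m+1)·(t − jR)) (ϱ·N m) (fun τ y => frameG E m (jR + τ/a (m+1)) (jR) y)`
(`Cα·strain m ≤ Cα·θ (m+1)` by `LPermissible.strain_le`): `FrameForm.isModulation_frameG_closed` (p704979) with its `hcurv` fed by `HCURV`
(same assembly through `isModulation_frameG_of_closed`, constants `Cα = 5C + 6C' + C♯ + 1`, `ϱ = 1`). [cite: ArmstrongVicol2025, §2.2 (PDF p. 18), §5.1] -/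
theorem isModulation_frameG_closed_of_hcurv
    (hK85 : (∀ k (W : LatticeWord k), ∃ θs > 0, ∃ Csharp ≥ 0, ∀ (E : LagrangianLatticeCarrier k) (θ₀ : ℝ), E.design = W → θ₀ ≤ θs →
      E.LPermissible → E.Regular → (∀ m, E.N m ^ 2 ≤ E.N (m + 1)) →
      (∀ m, E.θ (m + 1) * ((E.N (m + 1) : ℝ) / E.N m) ^ (1 / 16 : ℝ) ≤ θ₀) →
      ∀ (m : ℕ) (j : ℤ) (t : ℝ), (j : ℝ) * E.refresh (m + 1) < t → t ≤ ((j : ℝ) + 1) * E.refresh (m + 1) →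
      ∀ u ∈ Set.Icc 0 (t - (j : ℝ) * E.refresh (m + 1)), ∀ (y : UnitAddTorus (Fin 3)) (i l c : Fin 3),
        |Torus.partialDeriv c (fun y => frameG E m ((j : ℝ) * E.refresh (m + 1) + u) ((j : ℝ) * E.refresh (m + 1)) y i l) y|
          ≤ Csharp * E.N m * E.strain m))
    (k : ℕ) (W : LatticeWord k) :
    ∃ θs : ℝ, 0 < θs ∧ ∃ Cα : ℝ, 0 < Cα ∧ ∃ ϱ : ℝ, 0 < ϱ ∧
    ∀ (E : LagrangianLatticeCarrier k) (θ₀ : ℝ), E.design = W → θ₀ ≤ θs → E.LPermissible → E.Regular →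
      (∀ m, E.N m ^ 2 ≤ E.N (m + 1)) → (∀ m, E.θ (m + 1) * ((E.N (m + 1) : ℝ) / E.N m) ^ (1 / 16 : ℝ) ≤ θ₀) →
      ∀ (m : ℕ) (j : ℤ) (t : ℝ), (j : ℝ) * E.refresh (m + 1) < t → t ≤ ((j : ℝ) + 1) * E.refresh (m + 1) →
        CellClauseMod.IsModulation (Cα * E.strain m) (E.a (m + 1) * (t - (j : ℝ) * E.refresh (m + 1))) (ϱ * E.N m)
          (fun τ y => frameG E m ((j : ℝ) * E.refresh (m + 1) + τ / E.a (m + 1)) ((j : ℝ) * E.refresh (m + 1)) y) := by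
  obtain ⟨θ₁, hθ₁, C, hC, Hnear⟩ := abs_frameG_sub_one_le_strain_closed k W
  obtain ⟨θ₂, hθ₂, C', hC', Hrate⟩ := abs_partialDeriv_partialSum_le k W
  obtain ⟨θ₅, hθ₅, Cc, hCc, Hcurv⟩ := hK85 k W
  -- the constant and the ceiling (which also keeps `θ = Cα·strain m ≤ 1`)
  set Cα : ℝ := 5 * C + 6 * C' + Cc + 1 with hCα
  have hCα0 : 0 < Cα := by rw [hCα]; positivity
  refine ⟨min (min θ₁ θ₂) (min θ₅ (1 / (Cα + 1))), lt_min (lt_min hθ₁ hθ₂) (lt_min hθ₅ (by positivity)), Cα, hCα0, 1, one_pos, ?_⟩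
  intro E θ₀ hD hθs hLP hReg hsq hT4 m j t hst htR
  have hθs₁ : θ₀ ≤ θ₁ := hθs.trans ((min_le_left _ _).trans (min_le_left _ _))
  have hθs₂ : θ₀ ≤ θ₂ := hθs.trans ((min_le_left _ _).trans (min_le_right _ _))
  have hθs₅ : θ₀ ≤ θ₅ := hθs.trans ((min_le_right _ _).trans (min_le_left _ _))
  have hθs₃ : θ₀ ≤ 1 / (Cα + 1) := hθs.trans ((min_le_right _ _).trans (min_le_right _ _))
  have hLR := hReg.levelRegular
  have hF : E.IsFlow m := (hLP.isLagrangian m).1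
  set s : ℝ := (j : ℝ) * E.refresh (m + 1) with hs
  set S : ℝ := ∑ i ∈ Finset.range m, E.a (i + 1) with hS
  have hS0 : 0 ≤ S := Finset.sum_nonneg fun i _ => (E.toFractalCarrierData.a_pos _).le
  have hR0 : 0 < E.refresh (m + 1) := E.refresh_pos (m + 1)
  have hN0 : (0 : ℝ) < E.N m := by exact_mod_cast E.toFractalCarrierData.N_pos m
  have hTR : t - s ≤ E.refresh (m + 1) := by rw [hs]; linarith
  -- `θ = Cα·strain m ≤ 1`
  have hθm : E.θ (m + 1) ≤ θ₀ := theta_le_of_template E hLP hT4 m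
  have hstrain_def : E.strain m = S * E.refresh (m + 1) := by
    simp [LagrangianLatticeCarrier.strain, hS]
  have hstrain0 : 0 ≤ E.strain m := by rw [hstrain_def]; exact mul_nonneg hS0 hR0.le
  have hstrainθ : E.strain m ≤ θ₀ := (hLP.strain_le m).trans hθm
  have hθle1 : Cα * E.strain m ≤ 1 := by
    have h1 : Cα * θ₀ ≤ Cα * (1 / (Cα + 1)) := mul_le_mul_of_nonneg_left hθs₃ hCα0.le
    have h2 : Cα * (1 / (Cα + 1)) ≤ 1 := by
      rw [mul_one_div, div_le_one (by positivity)]; linarith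
    nlinarith [mul_le_mul_of_nonneg_left hstrainθ hCα0.le]
  have hθ0 : 0 ≤ Cα * E.strain m := mul_nonneg hCα0.le hstrain0
  -- the window strain budget on the closed piece: `S·u ≤ S·(t − s) ≤ S·R = strain m`
  have hSw : ∀ u ∈ Icc 0 (t - s), S * u ≤ E.strain m := fun u hu => by
    rw [hstrain_def]; exact mul_le_mul_of_nonneg_left (hu.2.trans hTR) hS0
  -- hnear (closed endpoint included)
  have hnear : ∀ u ∈ Icc 0 (t - s), ∀ (y : UnitAddTorus (Fin 3)) (i l : Fin 3),
      |frameG E m (s + u) s y i l - (1 : Matrix (Fin 3) (Fin 3) ℝ) i l| ≤ Cα * E.strain m := by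
    intro u hu y i l
    have h := Hnear E θ₀ hD hθs₁ hLP hReg hsq hT4 m j (s + u) (by rw [hs]; linarith [hu.1])
      (by rw [hs]; nlinarith [hu.2, hTR]) y i l
    have h5 : 5 * C * (S * (s + u - (j : ℝ) * E.refresh (m + 1))) ≤ 5 * C * E.strain m := by
      refine mul_le_mul_of_nonneg_left ?_ (by positivity)
      have e : s + u - (j : ℝ) * E.refresh (m + 1) = u := by rw [hs]; ring
      rw [e]; exact hSw u hu
    have h6 : 5 * C * E.strain m ≤ Cα * E.strain m := by
      rw [hCα]; nlinarith [mul_nonneg hC' hstrain0, mul_nonneg hCc hstrain0]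
    exact h.trans (h5.trans h6)
  -- hrate with `Cb = C'·S`, and the budget `3(1+θ)·Cb·(t−s) ≤ 6 C'·strain ≤ θ`
  have hrate : ∀ u ∈ Icc 0 (t - s), ∀ (y : UnitAddTorus (Fin 3)) (a q : Fin 3),
      |Torus.partialDeriv q (fun z => E.partialSum m (s + u) z a) (E.X m (s + u) s y)| ≤ C' * S :=
    fun u _ y a q => Hrate E θ₀ hD hθs₂ hLP hReg hsq hT4 m (s + u) _ a q
  have hbudget : 3 * (1 + Cα * E.strain m) * (C' * S) * (t - s) ≤ Cα * E.strain m := by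
    have hsw : S * (t - s) ≤ E.strain m := hSw (t - s) ⟨by linarith, le_rfl⟩
    have h1 : 3 * (1 + Cα * E.strain m) * (C' * S) * (t - s) ≤ 6 * C' * (S * (t - s)) := by
      have : (1 + Cα * E.strain m) ≤ 2 := by linarith
      have hSt : 0 ≤ S * (t - s) := mul_nonneg hS0 (by linarith)
      nlinarith [mul_nonneg hC' hSt]
    have h2 : 6 * C' * (S * (t - s)) ≤ 6 * C' * E.strain m := mul_le_mul_of_nonneg_left hsw (by positivity)
    have h3 : 6 * C' * E.strain m ≤ Cα * E.strain m := by
      rw [hCα]; nlinarith [mul_nonneg hC hstrain0, mul_nonneg hCc hstrain0]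
    linarith
  -- hcurv (K8-5, the hypothesis): `|∂_c G_{il}| ≤ C♯·N_m·strain m ≤ (Cα·strain m)·(1·N_m)`
  have hcurv : ∀ u ∈ Icc 0 (t - s), ∀ (y : UnitAddTorus (Fin 3)) (i l c : Fin 3),
      |Torus.partialDeriv c (fun y => frameG E m (s + u) s y i l) y| ≤ (Cα * E.strain m) * (1 * E.N m) := by
    intro u hu y i l c
    have h := Hcurv E θ₀ hD hθs₅ hLP hReg hsq hT4 m j t hst htR u hu y i l c
    refine h.trans ?_
    have hCcα : Cc ≤ Cα := by rw [hCα]; linarith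
    have h2 : Cc * E.N m * E.strain m ≤ Cα * E.N m * E.strain m :=
      mul_le_mul_of_nonneg_right (mul_le_mul_of_nonneg_right hCcα hN0.le) hstrain0
    rw [one_mul]
    linarith [mul_comm (E.N m : ℝ) (E.strain m)]
  -- assemble
  exact isModulation_frameG_of_closed E hLR hF j hst hTR hθ0 (mul_nonneg hC' hS0) hnear hrate hbudget
    (fun u hu i => FrameConj.isDivFree_frameG_col_closed E hLR hF j hTR hu i) hcurv

/-- **(hmod) with `j : ℕ` and `t ≤ jR + R`**, conditional on `HCURV` — literally the hypothesis `hmod` of `FrameConj.frameConjugacyAt_of_modulation`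
(p706082) at its two call sites, with `θ := Cα·strain m` (so `0 ≤ θ ≤ Cα·θ (m+1)`). -/
theorem isModulation_frameG_closed_of_hcurv_nat
    (hK85 : (∀ k (W : LatticeWord k), ∃ θs > 0, ∃ Csharp ≥ 0, ∀ (E : LagrangianLatticeCarrier k) (θ₀ : ℝ), E.design = W → θ₀ ≤ θs →
      E.LPermissible → E.Regular → (∀ m, E.N m ^ 2 ≤ E.N (m + 1)) →
      (∀ m, E.θ (m + 1) * ((E.N (m + 1) : ℝ) / E.N m) ^ (1 / 16 : ℝ) ≤ θ₀) →
      ∀ (m : ℕ) (j : ℤ) (t : ℝ), (j : ℝ) * E.refresh (m + 1) < t → t ≤ ((j : ℝ) + 1) * E.refresh (m + 1) →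
      ∀ u ∈ Set.Icc 0 (t - (j : ℝ) * E.refresh (m + 1)), ∀ (y : UnitAddTorus (Fin 3)) (i l c : Fin 3),
        |Torus.partialDeriv c (fun y => frameG E m ((j : ℝ) * E.refresh (m + 1) + u) ((j : ℝ) * E.refresh (m + 1)) y i l) y|
          ≤ Csharp * E.N m * E.strain m))
    (k : ℕ) (W : LatticeWord k) :
    ∃ θs : ℝ, 0 < θs ∧ ∃ Cα : ℝ, 0 < Cα ∧ ∃ ϱ : ℝ, 0 < ϱ ∧
    ∀ (E : LagrangianLatticeCarrier k) (θ₀ : ℝ), E.design = W → θ₀ ≤ θs → E.LPermissible → E.Regular →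
      (∀ m, E.N m ^ 2 ≤ E.N (m + 1)) → (∀ m, E.θ (m + 1) * ((E.N (m + 1) : ℝ) / E.N m) ^ (1 / 16 : ℝ) ≤ θ₀) →
      ∀ (m j : ℕ) (t : ℝ), (j : ℝ) * E.refresh (m + 1) < t → t ≤ (j : ℝ) * E.refresh (m + 1) + E.refresh (m + 1) →
        CellClauseMod.IsModulation (Cα * E.strain m) (E.a (m + 1) * (t - (j : ℝ) * E.refresh (m + 1))) (ϱ * E.N m)
          (fun τ y => frameG E m ((j : ℝ) * E.refresh (m + 1) + τ / E.a (m + 1)) ((j : ℝ) * E.refresh (m + 1)) y) := by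
  obtain ⟨θs, hθs, Cα, hCα, ϱ, hϱ, H⟩ := isModulation_frameG_closed_of_hcurv hK85 k W
  refine ⟨θs, hθs, Cα, hCα, ϱ, hϱ, fun E θ₀ hD hθ hLP hReg hsq hT4 m j t hjt htR => ?_⟩
  have h := H E θ₀ hD hθ hLP hReg hsq hT4 m (j : ℤ) t (by exact_mod_cast hjt) (by push_cast; linarith)
  simpa only [Int.cast_natCast] using h

/-! ## Appendix (2026-08-29, after K8-5 landed): the hypothesis-free modulation datum -/

/-- **(hmod) WITH NO HYPOTHESIS LEFT**: `isModulation_frameG_closed_of_hcurv` fed with the landed K8-5 theorem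
`FrameForm.abs_partialDeriv_frameG_le` (p707845, lead-k1l-onelevel-p1 g6) — for every design `W` there are `θs, Cα, ϱ > 0` such that every
`LPermissible`, `Regular` carrier of design `W` with `N_m² ≤ N_{m+1}` and the template (T4) at `θ₀ ≤ θs` has, on every piece `jR < t ≤ (j+1)R`,
`CellClauseMod.IsModulation (Cα·strain m) (a (m+1)·(t − jR)) (ϱ·N m) (fun τ y => frameG E m (jR + τ/a (m+1)) (jR) y)`.
[cite: ArmstrongVicol2025, §2.2 (PDF p. 18), §5.1] -/
theorem isModulation_frameG_closed_of_tower (k : ℕ) (W : LatticeWord k) :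
    ∃ θs : ℝ, 0 < θs ∧ ∃ Cα : ℝ, 0 < Cα ∧ ∃ ϱ : ℝ, 0 < ϱ ∧
    ∀ (E : LagrangianLatticeCarrier k) (θ₀ : ℝ), E.design = W → θ₀ ≤ θs → E.LPermissible → E.Regular →
      (∀ m, E.N m ^ 2 ≤ E.N (m + 1)) → (∀ m, E.θ (m + 1) * ((E.N (m + 1) : ℝ) / E.N m) ^ (1 / 16 : ℝ) ≤ θ₀) →
      ∀ (m : ℕ) (j : ℤ) (t : ℝ), (j : ℝ) * E.refresh (m + 1) < t → t ≤ ((j : ℝ) + 1) * E.refresh (m + 1) →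
        CellClauseMod.IsModulation (Cα * E.strain m) (E.a (m + 1) * (t - (j : ℝ) * E.refresh (m + 1))) (ϱ * E.N m)
          (fun τ y => frameG E m ((j : ℝ) * E.refresh (m + 1) + τ / E.a (m + 1)) ((j : ℝ) * E.refresh (m + 1)) y) :=
  isModulation_frameG_closed_of_hcurv abs_partialDeriv_frameG_le k W

/-- **(hmod) with `j : ℕ` and `t ≤ jR + R`, NO HYPOTHESIS LEFT** — literally the input `hmod` of `FrameConj.frameConjugacyAt_of_modulation`
(p706082) at its two call sites, with `θ := Cα·strain m` (`0 ≤ θ ≤ Cα·θ (m+1)` by `LPermissible.strain_le`) and `ϱ·N m`. -/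
theorem isModulation_frameG_closed_of_tower_nat (k : ℕ) (W : LatticeWord k) :
    ∃ θs : ℝ, 0 < θs ∧ ∃ Cα : ℝ, 0 < Cα ∧ ∃ ϱ : ℝ, 0 < ϱ ∧
    ∀ (E : LagrangianLatticeCarrier k) (θ₀ : ℝ), E.design = W → θ₀ ≤ θs → E.LPermissible → E.Regular →
      (∀ m, E.N m ^ 2 ≤ E.N (m + 1)) → (∀ m, E.θ (m + 1) * ((E.N (m + 1) : ℝ) / E.N m) ^ (1 / 16 : ℝ) ≤ θ₀) →
      ∀ (m j : ℕ) (t : ℝ), (j : ℝ) * E.refresh (m + 1) < t → t ≤ (j : ℝ) * E.refresh (m + 1) + E.refresh (m + 1) →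
        CellClauseMod.IsModulation (Cα * E.strain m) (E.a (m + 1) * (t - (j : ℝ) * E.refresh (m + 1))) (ϱ * E.N m)
          (fun τ y => frameG E m ((j : ℝ) * E.refresh (m + 1) + τ / E.a (m + 1)) ((j : ℝ) * E.refresh (m + 1)) y) :=
  isModulation_frameG_closed_of_hcurv_nat abs_partialDeriv_frameG_le k W

end Summit.AnomalousDissipation.AnomalousDissipation.Theorems.SolenoidalFractalHomogenisation.LagrangianStep.FrameForm

end
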